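import Summits.BirchSwinnertonDyer.BirchSwinnertonDyer.Theorems.CyclotomicUntwistNineLogUnbounded
import Summits.BirchSwinnertonDyer.BirchSwinnertonDyer.Theorems.CyclotomicUntwistNineDescendedFrobeniusOfOmegaColumn
import Summits.BirchSwinnertonDyer.BirchSwinnertonDyer.Theorems.CyclotomicUntwistNineIntegersLocalRing
import Literature.NumberTheory.EllipticCurves.FormalLogExpBaseChangeProofs
import Literature.NumberTheory.EllipticCurves.FormalGroupDictionaryProofs
import HarnessLib

/-!
# Galois descent on the `ω`-plane of Katz's module over `𝓞_{ℚ₃(ζ₉)}`: conjugate good models,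
# independence of `([ω], φ[ω])`, and `ℚ₃`-rationality of the `ω`-column — the named fact from the `η`-position

Cell `pub/bsd-wall`, D-0145 line `route-BirchSwinnertonDyer-CyclotomicUntwist`, lead seat `bsd-line-cycu-p1` (gen 6),
lane «HONDA OVER `𝓞_{ℚ₃(ζ₉)}`» (part 5). Helper toward the print input `WeierstrassCurve.isDescendedFrobeniusMatrix_exists`
of the K-SEP child C2 = stmt-BirchSwinnertonDyer-27549 (cruxes K1 `PSRankOneLowerHalfAtThree` = 21580 / K2 = 21581).

`Gal(ℚ₃(ζ₉)/ℚ₃)` acts on good models of a curve `W` DEFINED OVER `ℚ`: `τ` sends `𝓜 = (E, C)` to `𝓜^τ = (E^τ, C^τ)`, again a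
good model of `W`, with `classOmega(𝓜^τ) = τ_* classOmega(𝓜)` and `classEta(𝓜^τ) = τ_* classEta(𝓜)` coefficientwise
(`exists_conj_nineGoodModel`); bounded denominators and `φ = expand 3` commute with `τ_*`. Granted the MODEL TRANSPORT of
`ω`-column statements between two good models of `W` (an explicit hypothesis `hT` below — the lane of cycu-p4 g8,
`NineGoodModelTransport.classOmega_subst` / `exists_classEta_subst` plus the commutation of `expand 3` with the
transport series), this yields:

* `eigenvalue_fixed` — an eigenvalue `λ` of `φ` on the `ω`-line (`φ[ω] ≡ λ[ω]`) is fixed by `Gal(ℚ₃(ζ₉)/ℚ₃)`, hence lies in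
  `ℚ₃`; with `NineLogUnbounded.not_hbd_expand_sub_algebraMap_mul_classOmega` (Honda + Eisenstein):
  **`not_hbd_expand_sub_C_mul_classOmega`: on a good model with SUPERSINGULAR special fibre the `ω`-line carries NO
  eigenvalue at all**, and **`omegaPlane_independent`: `([ω], φ[ω])` is independent modulo bounded denominators** —
  the rank-2 lower bound `dim D(Ê/𝓞)⊗ℚ ≥ 2` in the kernel;
* `omegaColumn_rational` — an `ω`-column `φ[ω] ≡ c[ω] + d[η]` with `c, d ∈ ℚ₃(ζ₉)`, `d ≠ 0`, has `c, d ∈ ℚ₃`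
  (conjugate, transport back, compare by `ClassesIndependent`);
* `isDescendedFrobeniusMatrix_exists_of_etaPosition` — **the named fact `isDescendedFrobeniusMatrix_exists` FOLLOWS from the
  single statement «on a good model with supersingular special fibre, `[η_W] ≡ A[ω_W] + B·φ[ω_W]` modulo bounded
  denominators for some `A, B ∈ ℚ₃(ζ₉)`, `B ≠ 0`» (the position of the second Néron class — Katz 1981 Thm. 5.3.3/§5.9)
  together with the model-transport hypothesis `hT`**: `ω`-column `(−A/B, 1/B)`, rationality, transport to every model,
  independence on every model, then `NineDescendedFrobeniusOfOmegaColumn.isDescendedFrobeniusMatrix_of_omegaColumn`.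

THEOREMS ONLY (the transport and the `η`-position are explicit binders; no `def`, no named fact, no `sorry`); BSD is not
proved by this file and no crux is.

References: N. M. Katz, LNM 868 (1981) Thm. 5.3.3, §5.9 [Katz1981CrystallineDieudonne]; P. Berthelot, A. Ogus, Invent. Math.
72 (1983) (2.4), (3.14) [BerthelotOgus1983]; J. H. Silverman, AEC (2009) VII.1.3 [SilvermanAEC2009].
-/

-- single-conjunct summit: `Summit.BirchSwinnertonDyer.BirchSwinnertonDyer.…` repeats the name by design
set_option linter.dupNamespace false
set_option autoImplicit false

noncomputable section

open scoped Classical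
open PowerSeries IsCyclotomicExtension Literature.NumberTheory.EllipticCurves.DescendedFrobenius
  Summit.BirchSwinnertonDyer.BirchSwinnertonDyer.Theorems.NineIntegers
  Summit.BirchSwinnertonDyer.BirchSwinnertonDyer.Theorems.NineHondaEstimate
  Summit.BirchSwinnertonDyer.BirchSwinnertonDyer.Theorems.DescendedFrobeniusTransfer
  Summit.BirchSwinnertonDyer.BirchSwinnertonDyer.Theorems.NineHonda
  Summit.BirchSwinnertonDyer.BirchSwinnertonDyer.Theorems.NineLogUnbounded
  Summit.BirchSwinnertonDyer.BirchSwinnertonDyer.Theorems.NineDescendedFrobeniusOfOmegaColumn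

namespace Summit.BirchSwinnertonDyer.BirchSwinnertonDyer.Theorems.NineGaloisDescent

variable {W : WeierstrassCurve ℚ}

/-! ### §1 Conjugate good models -/

/-- `∫(xω − dz/z²)` commutes with base change along a ring map of `ℚ`-algebras. [cite: Katz1981CrystallineDieudonne, §5.1 (p. 193)] -/
theorem map_formalEtaIntegral {A B : Type*} [CommRing A] [CommRing B] [Algebra ℚ A] [Algebra ℚ B] (f : A →+* B)
    (V : WeierstrassCurve A) : (V.formalEtaIntegral).map f = (V.map f).formalEtaIntegral := by
  have hq : ∀ q : ℚ, f (algebraMap ℚ A q) = algebraMap ℚ B q := fun q =>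
    RingHom.congr_fun (RingHom.ext_rat (f.comp (algebraMap ℚ A)) (algebraMap ℚ B)) q
  ext n
  rw [coeff_map]
  rcases n with _ | n
  · simp only [coeff_zero_eq_constantCoeff, WeierstrassCurve.constantCoeff_formalEtaIntegral, map_zero]
  · rw [WeierstrassCurve.coeff_succ_formalEtaIntegral, WeierstrassCurve.coeff_succ_formalEtaIntegral, map_mul, hq,
      ← coeff_map, map_mul, WeierstrassCurve.map_formalXMulSq, WeierstrassCurve.map_formalOmega']

/-- **The conjugate good model.** For `τ ∈ Gal(ℚ₃(ζ₉)/ℚ₃)` and a good model `𝓜 = (E, C)` of `W/ℚ` over `𝓞`,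
`𝓜^τ = (E^τ, C^τ)` is a good model of `W` (`W` has rational coefficients, `τ` preserves `𝓞` and units) whose Néron
classes are the coefficientwise conjugates: `classOmega(𝓜^τ) = τ_* classOmega(𝓜)`, `classEta(𝓜^τ) = τ_* classEta(𝓜)`.
[cite: SilvermanAEC2009, VII.1.3] [cite: Katz1981CrystallineDieudonne, §5.1] -/
theorem exists_conj_nineGoodModel (𝓜 : W.NineGoodModel) (τ : KNine ≃ₐ[ℚ_[3]] KNine) :
    ∃ 𝓜' : W.NineGoodModel, 𝓜'.classOmega = (𝓜.classOmega).map (τ : KNine →+* KNine) ∧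
      𝓜'.classEta = (𝓜.classEta).map (τ : KNine →+* KNine) := by
  set ι := algebraMap ONine KNine with hι
  -- `τ` restricted to `𝓞`
  have hmem : ∀ x ∈ ONine, (τ : KNine →+* KNine) x ∈ ONine := fun x hx => algEquiv_mem τ hx
  let τO : ONine →+* ONine := (τ : KNine →+* KNine).restrict ONine ONine hmem
  have hτO : ∀ x : ONine, ι (τO x) = (τ : KNine →+* KNine) (ι x) := fun x =>
    RingHom.coe_restrict_apply (τ : KNine →+* KNine) ONine ONine hmem x
  have hcomp : ι.comp τO = (τ : KNine →+* KNine).comp ι := RingHom.ext hτO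
  -- the conjugate model
  have hsmul : (𝓜.C.map (τ : KNine →+* KNine)) • W.map (algebraMap ℚ KNine) = (𝓜.E.map τO).map ι := by
    have hW : W.map (algebraMap ℚ KNine) = (W.map (algebraMap ℚ KNine)).map (τ : KNine →+* KNine) := by
      rw [WeierstrassCurve.map_map]
      congr 1
      exact (RingHom.ext_rat _ _)
    rw [hW, WeierstrassCurve.map_variableChange, 𝓜.smul_eq, WeierstrassCurve.map_map, WeierstrassCurve.map_map, hcomp]
  let 𝓜' : W.NineGoodModel :=
    { E := 𝓜.E.map τO
      C := 𝓜.C.map (τ : KNine →+* KNine)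
      isUnit_Δ := by rw [WeierstrassCurve.map_Δ]; exact 𝓜.isUnit_Δ.map τO
      smul_eq := hsmul }
  have hcurve : 𝓜'.curve = 𝓜.curve.map (τ : KNine →+* KNine) := by
    show (𝓜.E.map τO).map ι = (𝓜.E.map ι).map (τ : KNine →+* KNine)
    rw [WeierstrassCurve.map_map, WeierstrassCurve.map_map, hcomp]
  have hu : ((𝓜'.C.u⁻¹ : KNineˣ) : KNine) = (τ : KNine →+* KNine) ((𝓜.C.u⁻¹ : KNineˣ) : KNine) := by
    show (((𝓜.C.map (τ : KNine →+* KNine)).u⁻¹ : KNineˣ) : KNine) = (τ : KNine →+* KNine) ((𝓜.C.u⁻¹ : KNineˣ) : KNine)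
    simp [WeierstrassCurve.VariableChange.map]
  have hu' : (𝓜'.C.u : KNine) = (τ : KNine →+* KNine) (𝓜.C.u : KNine) := by
    show (((𝓜.C.map (τ : KNine →+* KNine)).u : KNineˣ) : KNine) = (τ : KNine →+* KNine) (𝓜.C.u : KNine)
    simp [WeierstrassCurve.VariableChange.map]
  have hr : 𝓜'.C.r = (τ : KNine →+* KNine) 𝓜.C.r := rfl
  refine ⟨𝓜', ?_, ?_⟩
  · rw [WeierstrassCurve.NineGoodModel.classOmega, WeierstrassCurve.NineGoodModel.classOmega, hcurve,
      ← WeierstrassCurve.map_formalLog, hu, smul_eq_C_mul, smul_eq_C_mul, map_mul, map_C]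
  · rw [WeierstrassCurve.NineGoodModel.classEta, WeierstrassCurve.NineGoodModel.classEta, hcurve,
      ← WeierstrassCurve.map_formalLog, ← map_formalEtaIntegral, hu, hu', hr]
    simp only [smul_eq_C_mul, map_add, map_mul, map_C, mul_assoc]

/-! ### §2 Bounded denominators and `φ` under the Galois action -/

/-- `τ_*` preserves bounded denominators (`τ(𝓞) = 𝓞`). [cite: Katz1981CrystallineDieudonne, §5.1 (p. 193)] -/
theorem hbd_map (τ : KNine ≃ₐ[ℚ_[3]] KNine) {f : KNine⟦X⟧} (hf : HasBoundedDenominators f) :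
    HasBoundedDenominators (f.map (τ : KNine →+* KNine)) := by
  obtain ⟨d, hd⟩ := hf
  refine ⟨d, fun n => ?_⟩
  have h : (3 : KNine) ^ d * coeff n (f.map (τ : KNine →+* KNine)) = τ ((3 : KNine) ^ d * coeff n f) := by
    rw [coeff_map, map_mul, map_pow, map_ofNat]; rfl
  rw [h]
  exact algEquiv_mem τ (hd n)

/-! ### §3 Eigenvalues on the `ω`-line descend; independence of `([ω], φ[ω])` -/

/-- **Eigenvalues of `φ` on the `ω`-line are `Gal(ℚ₃(ζ₉)/ℚ₃)`-fixed**, granted the transport `hT` of `ω`-column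
statements between good models: conjugate `φ[ω] ≡ λ[ω]` to the model `𝓜^τ` (eigenvalue `τλ`), transport back to
`𝓜`, and compare by `NineLogUnbounded.eigenvalue_unique`. [cite: BerthelotOgus1983, Prop. (3.14)]
[cite: Katz1981CrystallineDieudonne, Thm. 5.3.3] -/
theorem eigenvalue_fixed (𝓜 : W.NineGoodModel) (ρ : ONine →+* ZMod 3)
    (hT : ∀ 𝓜₁ 𝓜₂ : W.NineGoodModel, ∀ c d : KNine,
      HasBoundedDenominators (expand 3 (by norm_num) 𝓜₂.classOmega - PowerSeries.C c * 𝓜₂.classOmega -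
        PowerSeries.C d * 𝓜₂.classEta) →
      HasBoundedDenominators (expand 3 (by norm_num) 𝓜₁.classOmega - PowerSeries.C c * 𝓜₁.classOmega -
        PowerSeries.C d * 𝓜₁.classEta))
    {lam : KNine} (h : HasBoundedDenominators (expand 3 (by norm_num) 𝓜.classOmega - PowerSeries.C lam * 𝓜.classOmega))
    (τ : KNine ≃ₐ[ℚ_[3]] KNine) : τ lam = lam := by
  obtain ⟨𝓜', hΩ, hH⟩ := exists_conj_nineGoodModel 𝓜 τ
  -- conjugate the eigen-relation to `𝓜'`
  have h' : HasBoundedDenominators (expand 3 (by norm_num) 𝓜'.classOmega - PowerSeries.C (τ lam) * 𝓜'.classOmega -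
      PowerSeries.C 0 * 𝓜'.classEta) := by
    have hm := hbd_map τ h
    rw [map_sub, map_mul, map_C, map_expand, ← hΩ] at hm
    rw [map_zero, zero_mul, sub_zero]
    exact hm
  -- transport back to `𝓜` and compare
  have hback := hT 𝓜 𝓜' (τ lam) 0 h'
  rw [map_zero, zero_mul, sub_zero] at hback
  exact (eigenvalue_unique 𝓜 ρ h hback).symm

/-- **No eigenvalue at all on the `ω`-line of a supersingular good model** (`3 ∣ a`), granted the transport `hT`:
an eigenvalue would be Galois-fixed, hence in `ℚ₃`, contradicting `not_hbd_expand_sub_algebraMap_mul_classOmega`.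
[cite: Katz1981CrystallineDieudonne, Thm. 5.3.3 and (6.1.1)] -/
theorem not_hbd_expand_sub_C_mul_classOmega (𝓜 : W.NineGoodModel) (ρ : ONine →+* ZMod 3)
    (hss : (3 : ℤ) ∣ 𝓜.specialFibreTrace ρ)
    (hT : ∀ 𝓜₁ 𝓜₂ : W.NineGoodModel, ∀ c d : KNine,
      HasBoundedDenominators (expand 3 (by norm_num) 𝓜₂.classOmega - PowerSeries.C c * 𝓜₂.classOmega -
        PowerSeries.C d * 𝓜₂.classEta) →
      HasBoundedDenominators (expand 3 (by norm_num) 𝓜₁.classOmega - PowerSeries.C c * 𝓜₁.classOmega -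
        PowerSeries.C d * 𝓜₁.classEta))
    (lam : KNine) :
    ¬ HasBoundedDenominators (expand 3 (by norm_num) 𝓜.classOmega - PowerSeries.C lam * 𝓜.classOmega) := by
  intro h
  haveI : FiniteDimensional ℚ_[3] KNine := IsCyclotomicExtension.finite {9} ℚ_[3] KNine
  haveI : IsGalois ℚ_[3] KNine := IsCyclotomicExtension.isGalois {9} ℚ_[3] KNine
  have hfix : ∀ τ : KNine ≃ₐ[ℚ_[3]] KNine, τ lam = lam := fun τ => eigenvalue_fixed 𝓜 ρ hT h τ
  obtain ⟨μ, hμ⟩ := (IsGalois.mem_range_algebraMap_iff_fixed lam).mpr hfix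
  rw [← hμ] at h
  exact not_hbd_expand_sub_algebraMap_mul_classOmega 𝓜 ρ hss μ h

/-- **`([ω], φ[ω])` is independent modulo bounded denominators** on a good model with supersingular special fibre
(granted the transport `hT`): `x[ω] + y·φ[ω] ≡ 0` forces `x = y = 0`. This is the kernel form of the lower bound
`rk D(Ê/𝓞) ⊗ ℚ ≥ 2`. [cite: Katz1981CrystallineDieudonne, Thm. 5.3.3] -/
theorem omegaPlane_independent (𝓜 : W.NineGoodModel) (ρ : ONine →+* ZMod 3)
    (hss : (3 : ℤ) ∣ 𝓜.specialFibreTrace ρ)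
    (hT : ∀ 𝓜₁ 𝓜₂ : W.NineGoodModel, ∀ c d : KNine,
      HasBoundedDenominators (expand 3 (by norm_num) 𝓜₂.classOmega - PowerSeries.C c * 𝓜₂.classOmega -
        PowerSeries.C d * 𝓜₂.classEta) →
      HasBoundedDenominators (expand 3 (by norm_num) 𝓜₁.classOmega - PowerSeries.C c * 𝓜₁.classOmega -
        PowerSeries.C d * 𝓜₁.classEta))
    (x y : KNine) (hxy : HasBoundedDenominators (PowerSeries.C x * 𝓜.classOmega +
      PowerSeries.C y * expand 3 (by norm_num) 𝓜.classOmega)) : x = 0 ∧ y = 0 := by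
  by_cases hy : y = 0
  · rw [hy, map_zero, zero_mul, add_zero] at hxy
    exact ⟨eq_zero_of_hbd_C_mul_classOmega 𝓜 ρ hxy, hy⟩
  · exfalso
    have h := hbd_C_mul y⁻¹ hxy
    have e : PowerSeries.C y⁻¹ * (PowerSeries.C x * 𝓜.classOmega + PowerSeries.C y * expand 3 (by norm_num) 𝓜.classOmega) =
        expand 3 (by norm_num) 𝓜.classOmega - PowerSeries.C (-(x * y⁻¹)) * 𝓜.classOmega := by
      rw [map_neg, map_mul]
      linear_combination (expand 3 (by norm_num) 𝓜.classOmega) * (C_mul_C_inv hy)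
    rw [e] at h
    exact not_hbd_expand_sub_C_mul_classOmega 𝓜 ρ hss hT _ h

/-! ### §4 `ClassesIndependent` and the `ℚ₃`-rationality of the `ω`-column -/

/-- `ClassesIndependent` from an `ω`-column over `ℚ₃(ζ₉)` (`d ≠ 0`) and the independence of `([ω], φ[ω])`.
[cite: Katz1981CrystallineDieudonne, Thm. 5.3.3] -/
theorem classesIndependent_of_omegaColumn' (𝓜 : W.NineGoodModel) {c d : KNine} (hd : d ≠ 0)
    (hω : HasBoundedDenominators (expand 3 (by norm_num) 𝓜.classOmega - PowerSeries.C c * 𝓜.classOmega -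
      PowerSeries.C d * 𝓜.classEta))
    (hind : ∀ x y : KNine, HasBoundedDenominators (PowerSeries.C x * 𝓜.classOmega +
      PowerSeries.C y * expand 3 (by norm_num) 𝓜.classOmega) → x = 0 ∧ y = 0) :
    𝓜.ClassesIndependent := by
  intro x y hxy
  rw [smul_eq_C_mul, smul_eq_C_mul] at hxy
  have h := (hbd_C_mul d hxy).add (hbd_C_mul y hω)
  have e : PowerSeries.C d * (PowerSeries.C x * 𝓜.classOmega + PowerSeries.C y * 𝓜.classEta) +
        PowerSeries.C y * (expand 3 (by norm_num) 𝓜.classOmega - PowerSeries.C c * 𝓜.classOmega -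
          PowerSeries.C d * 𝓜.classEta) =
      PowerSeries.C (d * x - y * c) * 𝓜.classOmega + PowerSeries.C y * expand 3 (by norm_num) 𝓜.classOmega := by
    simp only [map_sub, map_mul]
    ring
  rw [e] at h
  obtain ⟨h1, h2⟩ := hind _ _ h
  refine ⟨?_, h2⟩
  rw [h2, zero_mul, sub_zero] at h1
  exact (mul_eq_zero.mp h1).resolve_left hd

/-- **The `ω`-column is `ℚ₃`-rational.** If `φ[ω] ≡ c[ω] + d[η]` on a good model with supersingular special fibre,
`c, d ∈ ℚ₃(ζ₉)`, `d ≠ 0`, then (granted the transport `hT`) `c` and `d` are `Gal(ℚ₃(ζ₉)/ℚ₃)`-fixed, i.e. lie in `ℚ₃`: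
conjugate the relation to `𝓜^τ`, transport it back to `𝓜`, subtract, and use `ClassesIndependent`.
[cite: BerthelotOgus1983, Prop. (3.14)] [cite: Katz1981CrystallineDieudonne, Thm. 5.3.3] -/
theorem omegaColumn_rational (𝓜 : W.NineGoodModel) (ρ : ONine →+* ZMod 3) (hss : (3 : ℤ) ∣ 𝓜.specialFibreTrace ρ)
    (hT : ∀ 𝓜₁ 𝓜₂ : W.NineGoodModel, ∀ c d : KNine,
      HasBoundedDenominators (expand 3 (by norm_num) 𝓜₂.classOmega - PowerSeries.C c * 𝓜₂.classOmega -
        PowerSeries.C d * 𝓜₂.classEta) →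
      HasBoundedDenominators (expand 3 (by norm_num) 𝓜₁.classOmega - PowerSeries.C c * 𝓜₁.classOmega -
        PowerSeries.C d * 𝓜₁.classEta))
    {c d : KNine} (hd : d ≠ 0)
    (hω : HasBoundedDenominators (expand 3 (by norm_num) 𝓜.classOmega - PowerSeries.C c * 𝓜.classOmega -
      PowerSeries.C d * 𝓜.classEta)) :
    ∃ c₀ d₀ : ℚ_[3], algebraMap ℚ_[3] KNine c₀ = c ∧ algebraMap ℚ_[3] KNine d₀ = d := by
  haveI : FiniteDimensional ℚ_[3] KNine := IsCyclotomicExtension.finite {9} ℚ_[3] KNine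
  haveI : IsGalois ℚ_[3] KNine := IsCyclotomicExtension.isGalois {9} ℚ_[3] KNine
  have hI := classesIndependent_of_omegaColumn' 𝓜 hd hω (omegaPlane_independent 𝓜 ρ hss hT)
  have hfix : ∀ τ : KNine ≃ₐ[ℚ_[3]] KNine, τ c = c ∧ τ d = d := by
    intro τ
    obtain ⟨𝓜', hΩ, hH⟩ := exists_conj_nineGoodModel 𝓜 τ
    have hm := hbd_map τ hω
    rw [map_sub, map_sub, map_mul, map_mul, map_C, map_C, map_expand, ← hΩ, ← hH] at hm
    simp only [RingHom.coe_coe] at hm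
    have hback := hT 𝓜 𝓜' _ _ hm
    have hdiff := hω.sub hback
    have e : expand 3 (by norm_num) 𝓜.classOmega - PowerSeries.C c * 𝓜.classOmega - PowerSeries.C d * 𝓜.classEta -
        (expand 3 (by norm_num) 𝓜.classOmega - PowerSeries.C (τ c) * 𝓜.classOmega -
          PowerSeries.C (τ d) * 𝓜.classEta) =
        (τ c - c) • 𝓜.classOmega + (τ d - d) • 𝓜.classEta := by
      rw [smul_eq_C_mul, smul_eq_C_mul, map_sub, map_sub]
      ring
    rw [e] at hdiff
    obtain ⟨h1, h2⟩ := hI _ _ hdiff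
    exact ⟨(sub_eq_zero.mp h1), (sub_eq_zero.mp h2)⟩
  obtain ⟨c₀, hc₀⟩ := (IsGalois.mem_range_algebraMap_iff_fixed c).mpr fun τ => (hfix τ).1
  obtain ⟨d₀, hd₀⟩ := (IsGalois.mem_range_algebraMap_iff_fixed d).mpr fun τ => (hfix τ).2
  exact ⟨c₀, d₀, hc₀, hd₀⟩

/-! ### §5 The named fact from the `η`-position (modulo model transport) -/

/-- **`isDescendedFrobeniusMatrix_exists` FROM THE POSITION OF THE SECOND NÉRON CLASS.** Granted, for every `W` with a good
model over `𝓞`: (T) the transport of `ω`-column statements between any two good models of `W`, and (H) on every good model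
with supersingular special fibre some `A, B ∈ ℚ₃(ζ₉)`, `B ≠ 0`, with `[η_W] ≡ A[ω_W] + B·φ[ω_W]` modulo bounded
denominators — the named fact holds: the `ω`-column `(c, d) = (−A/B, 1/B)` is `ℚ₃`-rational (`omegaColumn_rational`),
transports to every model (T), the `ω`-plane is independent on every model (`omegaPlane_independent`), and
`NineDescendedFrobeniusOfOmegaColumn.isDescendedFrobeniusMatrix_of_omegaColumn` produces THE matrix with `det 3`, `tr a`.
(T) is kernel-sized (formal-group isomorphism between good models, cycu-p4 g8); (H) is the printed rank-2 statement.
[cite: Katz1981CrystallineDieudonne, Thm. 5.3.3 and §5.9] [cite: BerthelotOgus1983, Thm. (2.4) and Prop. (3.14)] -/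
theorem isDescendedFrobeniusMatrix_exists_of_etaPosition
    (hT : ∀ (W : WeierstrassCurve ℚ) (𝓜₁ 𝓜₂ : W.NineGoodModel) (c d : KNine),
      HasBoundedDenominators (expand 3 (by norm_num) 𝓜₂.classOmega - PowerSeries.C c * 𝓜₂.classOmega -
        PowerSeries.C d * 𝓜₂.classEta) →
      HasBoundedDenominators (expand 3 (by norm_num) 𝓜₁.classOmega - PowerSeries.C c * 𝓜₁.classOmega -
        PowerSeries.C d * 𝓜₁.classEta))
    (hH : ∀ (W : WeierstrassCurve ℚ) (𝓜 : W.NineGoodModel) (ρ : ONine →+* ZMod 3),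
      (3 : ℤ) ∣ 𝓜.specialFibreTrace ρ →
        ∃ A B : KNine, B ≠ 0 ∧ HasBoundedDenominators (𝓜.classEta - PowerSeries.C A * 𝓜.classOmega -
          PowerSeries.C B * expand 3 (by norm_num) 𝓜.classOmega)) :
    WeierstrassCurve.isDescendedFrobeniusMatrix_exists := by
  intro W 𝓜 ρ hss
  haveI := isElliptic_of_nineGoodModel 𝓜
  obtain ⟨A, B, hB, hη⟩ := hH W 𝓜 ρ hss
  -- the `ω`-column over `ℚ₃(ζ₉)`: `φΩ − (−A/B)Ω − B⁻¹ η = −B⁻¹ · (η − AΩ − BφΩ)`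
  have hω : HasBoundedDenominators (expand 3 (by norm_num) 𝓜.classOmega - PowerSeries.C (-(A * B⁻¹)) * 𝓜.classOmega -
      PowerSeries.C B⁻¹ * 𝓜.classEta) := by
    have h := hbd_C_mul (-B⁻¹) hη
    have e : PowerSeries.C (-B⁻¹) * (𝓜.classEta - PowerSeries.C A * 𝓜.classOmega -
        PowerSeries.C B * expand 3 (by norm_num) 𝓜.classOmega) =
        expand 3 (by norm_num) 𝓜.classOmega - PowerSeries.C (-(A * B⁻¹)) * 𝓜.classOmega -
          PowerSeries.C B⁻¹ * 𝓜.classEta := by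
      rw [map_neg, map_neg, map_mul]
      linear_combination (expand 3 (by norm_num) 𝓜.classOmega) * C_mul_C_inv hB
    rwa [e] at h
  have hd : (B⁻¹ : KNine) ≠ 0 := inv_ne_zero hB
  -- rationality of the column
  obtain ⟨c₀, d₀, hc₀, hd₀⟩ := omegaColumn_rational 𝓜 ρ hss (hT W) hd hω
  have hd₀ne : d₀ ≠ 0 := by
    rintro rfl
    rw [map_zero] at hd₀
    exact hd hd₀.symm
  rw [← hc₀, ← hd₀] at hω
  -- every model: same column (transport), independent `ω`-plane (trace is model-independent)
  have hω_all : ∀ 𝓜' : W.NineGoodModel, HasBoundedDenominators (expand 3 (by norm_num) 𝓜'.classOmega -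
      PowerSeries.C (algebraMap ℚ_[3] KNine c₀) * 𝓜'.classOmega -
      PowerSeries.C (algebraMap ℚ_[3] KNine d₀) * 𝓜'.classEta) := fun 𝓜' => hT W 𝓜' 𝓜 _ _ hω
  have hind_all : ∀ 𝓜' : W.NineGoodModel, ∀ x y : KNine, HasBoundedDenominators (PowerSeries.C x * 𝓜'.classOmega +
      PowerSeries.C y * expand 3 (by norm_num) 𝓜'.classOmega) → x = 0 ∧ y = 0 := fun 𝓜' => by
    have hss' : (3 : ℤ) ∣ 𝓜'.specialFibreTrace ρ := by
      rw [← specialFibreTrace_eq_of_nineGoodModel 𝓜 𝓜' ρ]; exact hss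
    exact omegaPlane_independent 𝓜' ρ hss' (hT W)
  exact ⟨_, isDescendedFrobeniusMatrix_of_omegaColumn 𝓜 ρ hd₀ne hω_all hind_all⟩

end Summit.BirchSwinnertonDyer.BirchSwinnertonDyer.Theorems.NineGaloisDescent

end
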